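import Literature.AlgebraicGeometry.HodgeTheory.BlochSemiregularityTheorem
import Literature.AlgebraicGeometry.HodgeTheory.FlatFamilyCycleClass
import Summits.HodgeConjecture.HodgeConjecture.Theorems.AnchorTransportVariationalHodgeStubCarriesClassOfCycleClass
import Summits.HodgeConjecture.HodgeConjecture.Theorems.AnchorTransportVariationalHodgeStubDominanceAlongSmooth
import HarnessLib

/-!
# Route HeckePrymWeil — `WeilTwelvefoldsSqrtMinus7` (stmt-HodgeConjecture-1261), line `semiregular-clean-lci-anchor`: glue `semiregularSpread_of_blochLifts_of_fulton`

The SPREAD step of the line (reshape r2 of the stub `stub_blochSemiregularSpread`): the conclusion of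
the monolithic named fact `BlochSemiregularSpread` — algebraicity of a global class `W` on the fibres
of a smooth projective family `f : 𝒳 ⟶ S` over an analytic neighbourhood of the anchor `s₀ ∈ S(ℂ)` —
derived from the two named facts shared with crux `stmt-HodgeConjecture-1076`
(line `polar-patch-broken-cycles`):

* `Bloch1972_semiregularSubschemeLifts` (Bloch 1972, Thm. (7.1) with the proof of Thm. (7.4);
  Artin 1969, Cor. (2.2)): a Bloch-semiregular local complete intersection `Z₀ ⊆ X₀ = 𝒳_{s₀}` of
  pure codimension `p`, the class of each of whose components stays of type `(p,p)` along the family,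
  lifts to a closed subscheme `𝒵 ⊆ 𝒳 ×_S V`, flat over an étale (hence smooth) `π : V ⟶ S`, with
  central fibre `Z₀` over a point `v₀ ↦ s₀`;
* `fulton1998_flatFamily_cycleClass_specialises` (Fulton 1998, Prop. 10.1 (a), Cor. 10.1,
  Lemma 19.1.1, Cor. 19.2 (b)): such a flat family has a global class `Γ` on `𝒳 ×_S V` with every
  fibre restriction algebraic and `Γ|_{X₀'} = c₀ • w + (class supported on the other components)`,
  `c₀ ≠ 0`, `0 ≠ w` supported on the chosen component.

**Statement.** For `f : 𝒳 ⟶ S` a smooth projective family of relative dimension `n`, projective in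
Hartshorne's sense, over a smooth `ℂ`-scheme `S`; `s₀ ∈ S(ℂ)`; `i₀ : Z₀ ↪ X₀` an INTEGRAL closed
subscheme which is a local complete intersection (conormal sheaf finite locally free) of codimension
exactly `p` (`Order.coheight ≥ p` at every point, `= p` somewhere) and Bloch-semiregular; and a global
class `W ∈ H²ᵖ(𝒳(ℂ); ℂ)` with all fibre restrictions of Hodge type `(p,p)` and `W|_{X₀}` supported on
`Z₀`: there is an open neighbourhood `U` of `s₀` in `S(ℂ)` (analytic topology) with `W|_{𝒳_t}`
algebraic for every `t ∈ U`.

**Proof.** (0) `p = 0`: every class is algebraic (`algebraicClasses_zero`). (1) `W|_{X₀} = 0`: by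
RIGIDITY of flat sections near a point of a smooth base (`exists_isOpen_forall_map_fiberι_eq_zero`,
Voisin II §3.1.2) `W|_{𝒳_t} = 0` for `pt t` in a Zariski neighbourhood of `pt s₀`, whose complex
points form an open set of `S(ℂ)` (`AlgPoints.isOpen_setOf_pt_mem`). (2) `W|_{X₀} ≠ 0`: the generic
point `η` of `Z₀` has codimension exactly `p` (coheight is antitone along `η ⤳ z`) and is the ONLY
point of codimension `p` (strict antitonicity, `Order.coheight_strictAnti`), with
`closure {η} = Z₀` in `X₀` (closed immersion); so `W` witnesses `SupportClassStaysHodge` for every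
component `closure {i₀ z}`, `codim z = p`, and Bloch's fact (`….of_smooth`) gives `π : V ⟶ S` smooth,
`v₀ ↦ s₀`, `𝒵 ⊆ 𝒳 ×_S V` flat over `V` with central fibre `Z₀`. Read the central fibre in
`X₀' = (𝒳 ×_S V)_{v₀}` through `θ : X₀' ≅ X₀` (`fiberOverFamilyPullbackIso`): it is the irreducible
closed `W₀' = θ⁻¹(Z₀)` of codimension exactly `p` (the set bookkeeping of
`stub_carriesClassOfCycleClass` with `C = ∅`). Fulton's fact for `g = familyPullback.snd f π`,
`𝒲 = 𝒵`, `W₀'`, `C = ∅` gives `Γ, w, c₀` with `Γ|_{X₀'} - c₀ • w` supported on `∅`, hence `= 0`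
(`classesSupportedOn_empty`). PURITY (`exists_ker_restrictCompl_le_span_of_isIrreducible`, Fulton
Lemma 19.1.1): the classes supported on `W₀'` form a line, so `θ^*(W|_{X₀}) = λ • w` with `λ ≠ 0`
(`θ^*` is injective, `complexBetti.bijective_map_of_iso`). The global class
`Θ = c₀ • pr^* W - λ • Γ` dies on `X₀'`, hence (rigidity again, over the smooth `V`) on `X_{t'}` for
`pt t'` in a Zariski open `U ∋ pt v₀`; there `pr^* W|_{X_{t'}} = (λ/c₀) • Γ|_{X_{t'}}` is algebraic,
i.e. (`map_fiberι_familyPullback_mem_algebraicClasses_iff`) `W|_{𝒳_{π t'}}` is algebraic. Finally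
`π(U)` is Zariski open in `S` (`π` smooth ⇒ open, `Scheme.Hom.isOpenMap`), contains `pt s₀ = π(pt v₀)`,
and every complex point of `S` over `π(U)` lifts to a complex point of `V` over `U`
(`exists_complexPoints_map_eq_of_pt_mem_image`); return `{t ∈ S(ℂ) | pt t ∈ π(U)}`.

## References

* S. Bloch, *Semi-regularity and de Rham cohomology*, Invent. Math. 17 (1972) 51–66: Thm. (7.1),
  proof of Thm. (7.4) (pp. 64–65), Remark (7.5).
* R.-O. Buchweitz, H. Flenner, *A semiregularity map for modules and applications to deformations*,
  Compositio Math. 137 (2003): §5, end of the proof of Thm. 5.1 / Thm. 5.2.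
* W. Fulton, *Intersection Theory*, 2nd ed. (1998): §10.1 Prop. 10.1 (a), Cor. 10.1; §19.1 eq. (1),
  Lemma 19.1.1; §19.2 Cor. 19.2 (b).
* C. Voisin, *Hodge Theory and Complex Algebraic Geometry II* (2003), §3.1.2 (flat sections), §9.2.
* M. Artin, *Algebraic approximation of structures over complete local rings*, Publ. Math. IHÉS 36
  (1969), Cor. (2.2).
-/

noncomputable section

-- every declaration of this problem lives in `Summit.HodgeConjecture.HodgeConjecture.…` (summit = sub-problem)
set_option linter.dupNamespace false

open CategoryTheory CategoryTheory.Limits AlgebraicGeometry MonoidalCategory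
open Literature.AlgebraicGeometry.Motives Literature.AlgebraicGeometry.HodgeTheory
open Literature.AlgebraicGeometry.Deformation

namespace Summit.HodgeConjecture.HodgeConjecture.Theorems.HeckePrymWeilLine

open Summit.HodgeConjecture.HodgeConjecture.Theorems

/-- **Glue `semiregularSpread_of_blochLifts_of_fulton` (line `semiregular-clean-lci-anchor`, the
SPREAD step; Bloch 1972 Thm. (7.4)/(7.5) in the input shape of the tree's object-level Bloch fact).**
Granted `Bloch1972_semiregularSubschemeLifts` and `fulton1998_flatFamily_cycleClass_specialises`:
for a smooth projective family `f : 𝒳 ⟶ S` of relative dimension `n`, projective in Hartshorne's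
sense, over a smooth `ℂ`-scheme `S`, a complex point `s₀`, an integral closed subscheme
`i₀ : Z₀ ↪ X₀ = 𝒳_{s₀}` which is a local complete intersection of codimension exactly `p` and
Bloch-semiregular, and a global class `W ∈ H²ᵖ(𝒳(ℂ); ℂ)` of fibrewise Hodge type `(p,p)` whose
restriction to `X₀` is supported on `Z₀`, the restriction `W|_{𝒳_t}` is algebraic for every `t` in
an open neighbourhood of `s₀` in `S(ℂ)`. Proof (module docstring): rigidity if `W|_{X₀} = 0`;
otherwise Bloch's lift `𝒵 ⊆ 𝒳 ×_S V` over a smooth `π : V ⟶ S`, Fulton's class `Γ` of the flat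
family, purity on the irreducible codimension-`p` central fibre, rigidity of `c₀ • pr^* W - λ • Γ`
near `v₀`, and descent along the open map `π` with lifting of complex points.
[cite: Bloch1972Semiregularity, Thm. (7.1), proof of Thm. (7.4) (pp. 64–65), Remark (7.5)]
[cite: BuchweitzFlenner2003, §5, end of the proof of Thm. 5.1 / Thm. 5.2]
[cite: Fulton1998, §10.1 Cor. 10.1; §19.1 Lemma 19.1.1]
[cite: VoisinHodgeII2003, §3.1.2] -/
theorem semiregularSpread_of_blochLifts_of_fulton
    (hB : Bloch1972_semiregularSubschemeLifts) (hF : fulton1998_flatFamily_cycleClass_specialises)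
    {𝒳 S : SchemeOver ℂ} (f : 𝒳 ⟶ S) (n p : ℕ) (hf : IsSmoothProjectiveFamily f n)
    (hproj : ∃ (N : ℕ) (ε : 𝒳 ⟶ projectiveSpace N ℂ ⊗ S), IsClosedImmersion ε.left ∧
      ε ≫ CartesianMonoidalCategory.snd (projectiveSpace N ℂ) S = f)
    (hS : AlgebraicGeometry.Smooth S.hom)
    (s₀ : ComplexPoints S) (Z₀ : Scheme) (i₀ : Z₀ ⟶ (fiberOver f s₀).left)
    (hi₀ : IsClosedImmersion i₀) (hlci : IsFiniteLocallyFree (conormalSheaf i₀))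
    (hint : AlgebraicGeometry.IsIntegral Z₀)
    (hcoh : ∀ z : Z₀, (p : ℕ∞) ≤ Order.coheight (i₀.base z))
    (hcohp : ∃ z : Z₀, Order.coheight (i₀.base z) = (p : ℕ∞))
    (hsr : IsBlochSemiregular i₀ n p)
    (W : complexBetti 𝒳 (2 * p))
    (hW : ∀ s : ComplexPoints S,
      IsOfHodgeType n (fiberOver f s) (2 * p) p p (complexBetti.map (fiberι f s) (2 * p) W))
    (hsupp : complexBetti.map (fiberι f s₀) (2 * p) W ∈
      classesSupportedOn (fiberOver f s₀) (Set.range i₀.base) (2 * p)) :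
    ∃ U : Set (ComplexPoints S), IsOpen U ∧ s₀ ∈ U ∧
      ∀ t ∈ U, complexBetti.map (fiberι f t) (2 * p) W ∈ algebraicClasses (fiberOver f t) p := by
  haveI := hS
  haveI := hi₀
  haveI := hint
  -- codimension `0`: every class is algebraic
  rcases Nat.eq_zero_or_pos p with rfl | hp
  · exact ⟨Set.univ, isOpen_univ, Set.mem_univ _, fun t _ => by
      rw [algebraicClasses_zero]; trivial⟩
  -- `W|_{X₀} = 0`: rigidity of the flat section near `s₀`
  by_cases h0 : complexBetti.map (fiberι f s₀) (2 * p) W = 0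
  · obtain ⟨U, hU, hs₀U, hrig⟩ := exists_isOpen_forall_map_fiberι_eq_zero f hf s₀
    refine ⟨{t | t.pt ∈ U}, AlgPoints.isOpen_setOf_pt_mem (X := S) (L := ℂ) ⟨U, hU⟩, hs₀U,
      fun t ht => ?_⟩
    rw [hrig (2 * p) W h0 t ht]
    exact Submodule.zero_mem _
  -- the generic point `η` of the integral `Z₀` has codimension exactly `p` in `X₀` …
  haveI : IrreducibleSpace Z₀ := inferInstance
  set η : Z₀ := genericPoint Z₀ with hηdef
  have hη : Order.coheight (i₀.base η) = (p : ℕ∞) := by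
    obtain ⟨z₁, hz₁⟩ := hcohp
    refine le_antisymm ?_ (hcoh η)
    rw [← hz₁]
    exact Order.coheight_anti (Scheme.le_iff_specializes.2
      ((genericPoint_specializes z₁).map i₀.continuous))
  -- … and every point of codimension `p` of `Z₀` has closure `⊇ Z₀` in `X₀` (it is `η`)
  have hgen : ∀ z : Z₀, Order.coheight (i₀.base z) = (p : ℕ∞) →
      Set.range i₀.base ⊆ closure {i₀.base z} := by
    intro z hz
    have hle : i₀.base z ≤ i₀.base η :=
      Scheme.le_iff_specializes.2 ((genericPoint_specializes z).map i₀.continuous)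
    have hsp : i₀.base z ⤳ i₀.base η := by
      by_contra hne
      have hlt : i₀.base z < i₀.base η := lt_of_le_not_ge hle (fun h => hne (Scheme.le_iff_specializes.1 h))
      have := Order.coheight_strictAnti hlt (by rw [hη]; exact ENat.coe_lt_top p)
      rw [hη, hz] at this
      exact lt_irrefl _ this
    have hcl : closure {i₀.base η} = Set.range i₀.base := by
      rw [← Set.image_singleton, i₀.isClosedEmbedding.closure_image_eq, hηdef,
        genericPoint_closure, Set.image_univ]
    rw [← hcl]
    exact specializes_iff_closure_subset.1 hsp
  -- Bloch: the semiregular lci `Z₀` lifts to a flat family over a smooth `π : V ⟶ S` through `s₀`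
  have hpure : ∀ z : Z₀, ∃ z' : Z₀, Order.coheight (i₀.base z') = (p : ℕ∞) ∧ i₀.base z' ⤳ i₀.base z :=
    fun z => ⟨η, hη, (genericPoint_specializes z).map i₀.continuous⟩
  have hclass : ∀ z : Z₀, Order.coheight (i₀.base z) = (p : ℕ∞) →
      SupportClassStaysHodge f n p s₀ (closure {i₀.base z}) :=
    fun z hz => (SupportClassStaysHodge.intro W hW hsupp h0).mono (hgen z hz)
  obtain ⟨V, π, hπ, v₀, hv₀, 𝒵, ι, hι, hflat, e, he⟩ :=
    hB.of_smooth f n p hf hproj hS s₀ Z₀ i₀ hi₀ hlci hpure hclass hsr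
  subst hv₀
  haveI := hπ
  haveI := hι
  haveI : AlgebraicGeometry.Smooth V.hom := by rw [← Over.w π]; infer_instance
  have hg : IsSmoothProjectiveFamily (familyPullback.snd f π) n := hf.familyPullback_snd π
  -- `θ : X₀' ≅ X₀`, the fibre of the base change over `v₀` and the fibre of `f` over `π v₀`
  set θ := fiberOverFamilyPullbackIso f π v₀ with hθdef
  have hhi : ∀ y, θ.hom.left.base (θ.inv.left.base y) = y := fun y => by
    rw [← Scheme.Hom.comp_apply, ← Over.comp_left, θ.inv_hom_id]; rfl
  have hih : ∀ x, θ.inv.left.base (θ.hom.left.base x) = x := fun x => by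
    rw [← Scheme.Hom.comp_apply, ← Over.comp_left, θ.hom_inv_id]; rfl
  -- the transported set `W₀' = θ⁻¹(Z₀)` on `X₀'`
  set W₀' : Set (fiberOver (familyPullback.snd f π) v₀).left := θ.hom.left.base ⁻¹' Set.range i₀.base
    with hW₀'
  have hW₀'c : IsClosed W₀' := i₀.isClosedEmbedding.isClosed_range.preimage θ.hom.left.continuous
  have hW₀'i : IsIrreducible W₀' := by
    have : W₀' = (fun w => θ.inv.left.base (i₀.base w)) '' Set.univ := by
      ext x
      simp only [hW₀', Set.mem_preimage, Set.mem_range, Set.image_univ]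
      constructor
      · rintro ⟨w, hw⟩
        exact ⟨w, by rw [hw, hih]⟩
      · rintro ⟨w, rfl⟩
        exact ⟨w, (hhi _).symm⟩
    rw [this]
    exact (IrreducibleSpace.isIrreducible_univ _).image _ (by fun_prop : Continuous _).continuousOn
  -- the central fibre of the flat family is `W₀'` (`∪ ∅`)
  have hsnd : pullback.snd ι (fiberι (familyPullback.snd f π) v₀).left ≫ θ.hom.left = e.hom ≫ i₀ := by
    haveI : Subsingleton ↥((specOver ℂ ℂ).left) := inferInstanceAs (Subsingleton (PrimeSpectrum ℂ))
    haveI : IsClosedImmersion (AlgPoints.map π v₀).left :=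
      isClosedImmersion_of_comp_eq_id _ _ (ComplexPoints.toSpecHom_comp_hom (AlgPoints.map π v₀))
    haveI : Mono (fiberι f (AlgPoints.map π v₀)).left := by
      change Mono (pullback.fst f.left (AlgPoints.map π v₀).left); infer_instance
    rw [← cancel_mono (fiberι f (AlgPoints.map π v₀)).left, Category.assoc, Category.assoc,
      ← Over.comp_left, hθdef, fiberOverFamilyPullbackIso_hom_fiberι, Over.comp_left,
      ← Category.assoc, ← pullback.condition, Category.assoc]
    exact he
  have hrange : Set.range (pullback.snd ι (fiberι (familyPullback.snd f π) v₀).left).base = W₀' ∪ ∅ := by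
    have key : ∀ z, θ.hom.left.base ((pullback.snd ι (fiberι (familyPullback.snd f π) v₀).left).base z) =
        i₀.base (e.hom.base z) := fun z => by
      rw [← Scheme.Hom.comp_apply, hsnd, Scheme.Hom.comp_apply]
    rw [Set.union_empty]
    ext x
    constructor
    · rintro ⟨z, rfl⟩
      exact ⟨e.hom.base z, (key z).symm⟩
    · rintro ⟨z₀, hz₀⟩
      obtain ⟨z, rfl⟩ := e.hom.surjective z₀
      exact ⟨z, by rw [← hih ((pullback.snd ι (fiberι (familyPullback.snd f π) v₀).left).base z),
          key, hz₀, hih]⟩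
  have hnot' : ¬ W₀' ⊆ ∅ := fun hsub => hsub (a := θ.inv.left.base (i₀.base η)) ⟨η, (hhi _).symm⟩
  have hcoh' : ∀ z ∈ W₀' ∪ ∅, (p : ℕ∞) ≤ Order.coheight z := by
    intro z hz
    rw [Set.union_empty] at hz
    obtain ⟨w, hw⟩ := hz
    rw [← coheight_left_base_eq_of_iso θ z, ← hw]
    exact hcoh w
  have hcoh2' : ∃ z ∈ W₀', Order.coheight z = (p : ℕ∞) :=
    ⟨θ.inv.left.base (i₀.base η), ⟨η, (hhi _).symm⟩, by
      rw [← hη, ← coheight_left_base_eq_of_iso θ, hhi]⟩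
  -- the flat-family cycle class (Fulton)
  obtain ⟨Γ, w, c₀, hΓ, hw, hw0, hc0, hΓw⟩ := hF (p := p) (familyPullback.snd f π) hg ‹_› 𝒵 ι hι
    hflat v₀ W₀' ∅ hW₀'c hW₀'i isClosed_empty hrange hnot' hcoh' hcoh2'
  -- no non-zero class is supported on `∅`: `Γ|_{X₀'} = c₀ • w`
  have hΓv₀ : complexBetti.map (fiberι (familyPullback.snd f π) v₀) (2 * p) Γ = c₀ • w := by
    rw [classesSupportedOn_empty, Submodule.mem_bot] at hΓw
    exact sub_eq_zero.1 hΓw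
  -- purity: the classes supported on `W₀'` form a line, so `θ^* (W|_{X₀}) = λ • w`, `λ ≠ 0`
  obtain ⟨τ, hτ⟩ := exists_ker_restrictCompl_le_span_of_isIrreducible (hg.isSmoothProjective v₀)
    hW₀'c hW₀'i (c := p) hp fun z hz => hcoh' z (Or.inl hz)
  set x₀ := complexBetti.map (fiberι f (AlgPoints.map π v₀)) (2 * p) W with hx₀def
  have hx₀' : complexBetti.map θ.hom (2 * p) x₀ ∈ classesSupportedOn _ W₀' (2 * p) :=
    mem_classesSupportedOn_iff.2
      (complexBetti.restrictCompl_map_eq_zero θ.hom (mem_classesSupportedOn_iff.1 hsupp))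
  obtain ⟨lam, hlam⟩ : ∃ lam : ℂ, complexBetti.map θ.hom (2 * p) x₀ = lam • w := by
    obtain ⟨a, ha⟩ := Submodule.mem_span_singleton.1 (hτ hw)
    obtain ⟨b, hb⟩ := Submodule.mem_span_singleton.1 (hτ hx₀')
    have ha0 : a ≠ 0 := by
      rintro rfl
      exact hw0 (by rw [← ha, zero_smul])
    exact ⟨b / a, by rw [← hb, ← ha, smul_smul, div_mul_cancel₀ b ha0]⟩
  have hlam0 : lam ≠ 0 := by
    rintro rfl
    rw [zero_smul] at hlam
    exact h0 ((complexBetti.bijective_map_of_iso θ (2 * p)).1 (by rw [hlam, map_zero]))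
  -- the global class `Θ := c₀ • pr^* W - λ • Γ` on `𝒳 ×_S V` vanishes on `X₀'`
  set Θ : complexBetti (familyPullback f π) (2 * p) :=
    c₀ • complexBetti.map (familyPullback.fst f π) (2 * p) W - lam • Γ with hΘ
  have hΘ0 : complexBetti.map (fiberι (familyPullback.snd f π) v₀) (2 * p) Θ = 0 := by
    rw [hΘ, map_sub, map_smul, map_smul, map_fiberι_familyPullback, ← hθdef, ← hx₀def, hlam, hΓv₀,
      smul_comm, sub_self]
  -- rigidity over a Zariski neighbourhood `U` of `v₀`: there `pr^* W|_{X_{t'}} = (λ/c₀) • Γ|_{X_{t'}}`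
  obtain ⟨U, hU, hv₀U, hrig⟩ := exists_isOpen_forall_map_fiberι_eq_zero (familyPullback.snd f π) hg v₀
  have halg : ∀ t' : ComplexPoints V, t'.pt ∈ U →
      complexBetti.map (fiberι f (AlgPoints.map π t')) (2 * p) W ∈
        algebraicClasses (fiberOver f (AlgPoints.map π t')) p := by
    intro t' ht'
    rw [← map_fiberι_familyPullback_mem_algebraicClasses_iff f π hf W t']
    have hM := hrig (2 * p) Θ hΘ0 t' ht'
    rw [hΘ, map_sub, map_smul, map_smul, sub_eq_zero] at hM
    have hM' : complexBetti.map (fiberι (familyPullback.snd f π) t') (2 * p)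
        (complexBetti.map (familyPullback.fst f π) (2 * p) W) =
        c₀⁻¹ • (lam • complexBetti.map (fiberι (familyPullback.snd f π) t') (2 * p) Γ) := by
      rw [← hM, smul_smul, inv_mul_cancel₀ hc0, one_smul]
    rw [hM']
    exact Submodule.smul_mem _ _ (Submodule.smul_mem _ _ (hΓ t'))
  -- the image `π(U)` is a Zariski neighbourhood of `pt s₀`, and complex points over it lift to `U`
  haveI : LocallyOfFiniteType S.hom := inferInstance
  haveI : LocallyOfFiniteType π.left := inferInstance
  have hπU : IsOpen ((π.left : V.left → S.left) '' U) := π.left.isOpenMap U hU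
  refine ⟨{t | t.pt ∈ (π.left : V.left → S.left) '' U},
    AlgPoints.isOpen_setOf_pt_mem (X := S) (L := ℂ) ⟨_, hπU⟩, ⟨v₀.pt, hv₀U, rfl⟩, fun t ht => ?_⟩
  obtain ⟨t', ht'U, rfl⟩ := exists_complexPoints_map_eq_of_pt_mem_image π hU t ht
  exact halg t' ht'U

end Summit.HodgeConjecture.HodgeConjecture.Theorems.HeckePrymWeilLine

end
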